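import Summits.HodgeConjecture.HodgeConjecture.Theses.EndoscopicMiddleDegree
import Literature.AlgebraicGeometry.HodgeTheory.CorrespondenceComposition
import Literature.AlgebraicGeometry.HodgeTheory.GysinBaseChange
import Literature.AlgebraicGeometry.HodgeTheory.ComplexGysinCorrespondence
import Literature.AlgebraicGeometry.HodgeTheory.CorrespondenceActionOfGraph
import HarnessLib

/-!
# Route NikulinTwinTransport · crux `TwinSimilitudeAlgebraic` (stmt-HodgeConjecture-13674) —
# stub `stub_corrCalculus` of line `hyperkaehler-nikulin-anchors` (reshape r2)

**The formal correspondence calculus on the tree's real carriers** (`complexBetti X k = Hᵏ(X(ℂ); ℂ)`,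
`complexGysin μ` the Gysin push-forward of an orientation family `μ`, and
`corrAction μ hW hX hab γ = [γ]_* = pr_{W*}(pr_X^* – ∪ γ)`, the FIRST factor receiving), in the
two shapes the line `hyperkaehler-nikulin-anchors` consumes when it composes three algebraic
correspondences `S ⊢ S^[2] ⊢ X ⊢ F` and lets the graph of a closed immersion `ν : F ⟶ X` act as
`ν^*`:

* (i) `CorrCompOfCup` (`corrCompOfCup_holds`) — **composition of algebraic correspondences in all
  dimensions, GRANTED `CupProductAlgebraic`** (route item stmt-HodgeConjecture-14350: cup products
  of algebraic classes are algebraic). For smooth projective `A, B, C` of dimensions `l, m, n`,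
  `γ ∈ Nᵐ H²ᵐ((A ⊗ B)(ℂ))` (a degree-`0` correspondence `B ⊢ A`) and `γ' ∈ Nⁿ H²ⁿ((B ⊗ C)(ℂ))`
  (degree `0`, `C ⊢ B`), the class `γ'' = c • p₁₃₊(p₁₂^* γ ∪ p₂₃^* γ') ∈ Nⁿ H²ⁿ((A ⊗ C)(ℂ))` is
  algebraic (`corrCompClass_mem_algebraicClasses`, whose multiplicativity input `hCUP` on
  `A ⊗ (B ⊗ C)` is the instance of `CupProductAlgebraic`) and acts on `Hᵏ(C)` as
  `[γ]_* ∘ [γ']_*` (`corr_comp_of_baseChange` with the PROVED Gysin base change `gysin_baseChange`,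
  which supplies the scalar `c`) — Fulton Prop. 16.1.1 / Def. 16.1.2, Buskin Lemma 6.3; the
  all-dimension version of the tree's `corrComp_surfaces_of_cup` and of
  `exists_algebraic_corrAction_comp`.
* (ii) `GraphClassPullback` (`graphClassPullback_holds`) — **the graph class of a morphism acts as
  the pull-back**: for `ν : F ⟶ X` between smooth projective varieties of dimensions `d, n`, the
  Gysin image `γ = (𝟙 F, ν)₊ 1 ∈ Nⁿ H²ⁿ((F ⊗ X)(ℂ))` of `1 ∈ H⁰(F(ℂ))` under
  `lift (𝟙 F) ν : F ⟶ F ⊗ X` is algebraic (`complexGysin_mem_supportedClasses` with the proved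
  support property `gysinMap_restrictCompl_eq_zero_of_field ℂ`) and `[γ]_* b = ν^* b` on `Hᵏ(X)`
  (projection formula `complexGysin_cup`, `cupProduct_one`, `lift_snd`, `complexGysin_comp`,
  `lift_fst`, `complexGysin_id`) — Fulton Def. 16.1.2 / Prop. 16.1.2 (c); the `F ⊗ X` version of
  the tree's `corrAction_gysinGraph_one`.

`stub_corrCalculus` is their conjunction, symbol for symbol the registered stub of the skeleton
`Cruxes/TwinSimilitudeAlgebraic/Lines/hyperkaehler_nikulin_anchors.lean` (reshape r2).
Everything is proved; no named facts, no definitions; `CupProductAlgebraic` is a hypothesis of (i).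

## References

* [Fulton1998] W. Fulton, Intersection Theory, 2nd ed., Springer 1998, §16.1 Def. 16.1.1,
  Def. 16.1.2, Prop. 16.1.1, Prop. 16.1.2; Prop. 1.7.
* [Buskin2019] N. Buskin, Every rational Hodge isometry between two K3 surfaces is algebraic,
  J. reine angew. Math. 755 (2019), §6.2 Lemma 6.3.
* [FultonYoungTableaux1997] W. Fulton, Young Tableaux, CUP 1997, Appendix B §B.1 (2)–(6), §B.3.
* [VoisinHodgeII2003] C. Voisin, Hodge Theory and Complex Algebraic Geometry II, CUP 2003, §9.2.4
  Prop. 9.20.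
-/

noncomputable section

set_option linter.dupNamespace false

open CategoryTheory MonoidalCategory CartesianMonoidalCategory
open Literature.AlgebraicGeometry.Motives Literature.AlgebraicGeometry.HodgeTheory
open Literature.AlgebraicTopology.SingularHomology

namespace Summit.HodgeConjecture.HodgeConjecture.Theorems.NikulinTwinTransport

/-- **Composition of algebraic correspondences of degree `0` in all dimensions, granted
`CupProductAlgebraic`** (Fulton Prop. 16.1.1 / Def. 16.1.2 with Buskin's Lemma 6.3). For an
orientation family `μ` with Poincaré duality, smooth projective `A, B, C` of dimensions `l, m, n`,
and algebraic `γ ∈ Nᵐ H²ᵐ((A ⊗ B)(ℂ))`, `γ' ∈ Nⁿ H²ⁿ((B ⊗ C)(ℂ))`, there is an algebraic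
`γ'' ∈ Nⁿ H²ⁿ((A ⊗ C)(ℂ))` with `[γ'']_* y = [γ]_* ([γ']_* y)` for all `y ∈ Hᵏ(C(ℂ); ℂ)`, namely
`γ'' = c • p₁₃₊(p₁₂^* γ ∪ p₂₃^* γ')` (`p₁₂ = A ◁ fst`, `p₂₃ = snd`, `p₁₃ = A ◁ snd` on
`A ⊗ (B ⊗ C)`): the composition rule is `corr_comp_of_baseChange` fed with the proved Gysin base
change `gysin_baseChange` (which supplies `c`), and `γ''` is algebraic by
`corrCompClass_mem_algebraicClasses`, whose multiplicativity hypothesis `Nᵐ ∪ Nⁿ ⊆ Nᵐ⁺ⁿ` on the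
triple product `A ⊗ (B ⊗ C)` is the instance of `CupProductAlgebraic` there.
[cite: Fulton1998, §16.1 Prop. 16.1.1 and Def. 16.1.2] [cite: Buskin2019, Lemma 6.3]
[cite: VoisinHodgeII2003, §9.2.4 Prop. 9.20] -/
theorem corrCompOfCup_holds
    (hCPA : Summit.HodgeConjecture.HodgeConjecture.Theses.EndoscopicMiddleDegree.CupProductAlgebraic)
    {μ : OrientationFamily} (hμ : μ.HasPoincareDuality) {A B C : SchemeOver ℂ} {l m n : ℕ} (k : ℕ)
    (hA : IsSmoothProjective l A) (hB : IsSmoothProjective m B) (hC : IsSmoothProjective n C)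
    {γ : complexBetti (A ⊗ B) (2 * m)} (hγ : γ ∈ algebraicClasses (A ⊗ B) m)
    {γ' : complexBetti (B ⊗ C) (2 * n)} (hγ' : γ' ∈ algebraicClasses (B ⊗ C) n) :
    ∃ γ'' ∈ algebraicClasses (A ⊗ C) n, ∀ y : complexBetti C k,
      corrAction μ hA hC (rfl : k + 2 * n = k + 2 * n) γ'' y =
        corrAction μ hA hB (rfl : k + 2 * m = k + 2 * m) γ
          (corrAction μ hB hC (rfl : k + 2 * n = k + 2 * n) γ' y) := by
  -- Gysin base change for the square `A ⊗ (B ⊗ C) → B ⊗ C` over `A ⊗ B → B`, with its scalar `c`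
  obtain ⟨c, hc⟩ := gysin_baseChange μ hA hB hC (show k + 2 * n + 2 * m = k + 2 * (m + n) by omega)
  -- the multiplicativity `Nᵐ ∪ Nⁿ ⊆ Nᵐ⁺ⁿ` on `A ⊗ (B ⊗ C)`: the instance of `CupProductAlgebraic`
  have hCUP : ∀ a ∈ algebraicClasses (A ⊗ (B ⊗ C)) m, ∀ b ∈ algebraicClasses (A ⊗ (B ⊗ C)) n,
      cupProduct ((Nat.mul_add 2 m n).symm : 2 * m + 2 * n = 2 * (m + n)) a b ∈
        algebraicClasses (A ⊗ (B ⊗ C)) (m + n) :=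
    fun a ha b hb => hCPA (IsSmoothProjective.tensor_holds hA (IsSmoothProjective.tensor_holds hB hC))
      m n a b ha hb
  refine ⟨c • complexGysin μ
      (IsSmoothProjective.tensor_holds hA (IsSmoothProjective.tensor_holds hB hC))
      (IsSmoothProjective.tensor_holds hA hC) (A ◁ snd B C)
      (show 2 * (m + n) + 2 * (l + n) = 2 * n + 2 * (l + (m + n)) by omega)
      (cupProduct ((Nat.mul_add 2 m n).symm : 2 * m + 2 * n = 2 * (m + n))
        (complexBetti.map (A ◁ fst B C) (2 * m) γ) (complexBetti.map (snd A (B ⊗ C)) (2 * n) γ')),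
    Submodule.smul_mem _ c (corrCompClass_mem_algebraicClasses hμ hA hB hC (e := m) (e' := n)
      (e'' := n) (Nat.add_comm m n) hCUP hγ hγ'), fun y => ?_⟩
  rw [corrAction_apply, corrAction_apply, corrAction_apply]
  exact corr_comp_of_baseChange hμ hA hB hC (e := m) (j := 2 * n) (k := 2 * n) (d := 2 * (m + n))
    (a := k) (a₁ := k) (a₂ := k) rfl rfl (Nat.add_comm _ _) ((Nat.mul_add 2 m n).symm) γ γ' c hc y

/-- **The graph class of a morphism is algebraic and acts as the pull-back** (Fulton Def. 16.1.2,
Prop. 16.1.2 (c): the transpose of the graph `Γ_ν` acts as `ν^*`). For an orientation family `μ`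
with Poincaré duality, smooth projective `F, X` of dimensions `d, n` and `ν : F ⟶ X`, the Gysin
image `γ = (𝟙 F, ν)₊ 1 ∈ H²ⁿ((F ⊗ X)(ℂ); ℂ)` of `1 ∈ H⁰(F(ℂ); ℂ)` under `lift (𝟙 F) ν : F ⟶ F ⊗ X`
lies in `Nⁿ H²ⁿ = algebraicClasses (F ⊗ X) n` (proper push-forward shifts the coniveau by the
relative dimension `n`, `complexGysin_mem_supportedClasses` with the proved support property
`gysinMap_restrictCompl_eq_zero_of_field ℂ`, and `1 ∈ N⁰ H⁰ = H⁰`), and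
`[γ]_* b = pr_{F*}(pr_X^* b ∪ (𝟙, ν)₊ 1) = (𝟙 F)₊ (ν^* b) = ν^* b` on `Hᵏ(X(ℂ); ℂ)`: projection
formula `complexGysin_cup` read right to left, `∪ 1 = id` (`cupProduct_one`),
`(𝟙, ν)^* pr_X^* = ν^*` (`lift_snd`), `pr_{F*} (𝟙, ν)₊ = ((𝟙, ν) ≫ pr_F)₊ = (𝟙 F)₊`
(`complexGysin_comp`, `lift_fst`) and `(𝟙 F)₊ = id` (`complexGysin_id`).
[cite: Fulton1998, §16.1 Def. 16.1.2 and Prop. 16.1.1]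
[cite: FultonYoungTableaux1997, Appendix B §B.1 (2), (5), (6) and §B.3] -/
theorem graphClassPullback_holds {μ : OrientationFamily} (hμ : μ.HasPoincareDuality)
    {F X : SchemeOver ℂ} {d n : ℕ} (k : ℕ) (hF : IsSmoothProjective d F)
    (hX : IsSmoothProjective n X) (ν : F ⟶ X) :
    ∃ γ ∈ algebraicClasses (F ⊗ X) n, ∀ b : complexBetti X k,
      corrAction μ hF hX (rfl : k + 2 * n = k + 2 * n) γ b = complexBetti.map ν k b := by
  have hFX := IsSmoothProjective.tensor_holds hF hX
  refine ⟨complexGysin μ hF hFX (lift (𝟙 F) ν) (show 0 + 2 * (d + n) = 2 * n + 2 * d by omega)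
      (singularCohomology.one ℂ (ComplexPoints F)),
    complexGysin_mem_supportedClasses (gysinMap_restrictCompl_eq_zero_of_field ℂ) μ hμ hF hFX
      (lift (𝟙 F) ν) _ (r := 0) (by omega)
      (by rw [supportedClasses_zero]; exact Submodule.mem_top),
    fun b => ?_⟩
  rw [corrAction_apply,
    ← complexGysin_cup hμ hF hFX (lift (𝟙 F) ν) (Nat.add_zero k)
      (show k + 2 * (d + n) = k + 2 * n + 2 * d by omega)
      (show 0 + 2 * (d + n) = 2 * n + 2 * d by omega) rfl
      (complexBetti.map (snd F X) k b) (singularCohomology.one ℂ (ComplexPoints F)),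
    cupProduct_one, ← CategoryTheory.comp_apply, ← complexBetti.map_comp, lift_snd,
    ← LinearMap.comp_apply (f := complexGysin μ hFX hF (fst F X) _),
    ← complexGysin_comp hμ hF hFX hF (lift (𝟙 F) ν) (fst F X)]
  simp only [lift_fst]
  rw [complexGysin_id hμ hF k, LinearMap.id_apply]

/-- **Stub `stub_corrCalculus` of line `hyperkaehler-nikulin-anchors`** (registered r2;
`CorrCalculus := CorrCompOfCup ∧ GraphClassPullback` of the skeleton): (i) GRANTED
`CupProductAlgebraic` (item stmt-HodgeConjecture-14350), algebraic correspondences of degree `0`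
compose in all dimensions — for smooth projective `A, B, C` of dimensions `l, m, n`,
`γ ∈ Nᵐ H²ᵐ((A ⊗ B)(ℂ))` and `γ' ∈ Nⁿ H²ⁿ((B ⊗ C)(ℂ))`, some algebraic `γ'' ∈ Nⁿ((A ⊗ C)(ℂ))` acts
on `Hᵏ(C)` as `[γ]_* ∘ [γ']_*` (`corrCompOfCup_holds`: Fulton Prop. 16.1.1,
`γ'' = c • p₁₃₊(p₁₂^* γ ∪ p₂₃^* γ')`); (ii) for `ν : F ⟶ X` between smooth projective varieties,
the graph class `(𝟙, ν)₊ 1 ∈ Nⁿ((F ⊗ X)(ℂ))` is algebraic and acts on `Hᵏ(X)` as `ν^*`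
(`graphClassPullback_holds`: Fulton Def. 16.1.2). [cite: Fulton1998, §16.1 Prop. 16.1.1 and Def. 16.1.2]
[cite: Buskin2019, Lemma 6.3] -/
theorem stub_corrCalculus :
    (Summit.HodgeConjecture.HodgeConjecture.Theses.EndoscopicMiddleDegree.CupProductAlgebraic →
      ∀ (μ : OrientationFamily), μ.HasPoincareDuality →
        ∀ (A B C : SchemeOver ℂ) (l m n k : ℕ) (hA : IsSmoothProjective l A)
          (hB : IsSmoothProjective m B) (hC : IsSmoothProjective n C),
          ∀ γ ∈ algebraicClasses (A ⊗ B) m, ∀ γ' ∈ algebraicClasses (B ⊗ C) n,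
            ∃ γ'' ∈ algebraicClasses (A ⊗ C) n, ∀ y : complexBetti C k,
              corrAction μ hA hC (rfl : k + 2 * n = k + 2 * n) γ'' y =
                corrAction μ hA hB (rfl : k + 2 * m = k + 2 * m) γ
                  (corrAction μ hB hC (rfl : k + 2 * n = k + 2 * n) γ' y)) ∧
    (∀ (μ : OrientationFamily), μ.HasPoincareDuality →
      ∀ (F X : SchemeOver ℂ) (d n k : ℕ) (hF : IsSmoothProjective d F) (hX : IsSmoothProjective n X)
        (ν : F ⟶ X),
        ∃ γ ∈ algebraicClasses (F ⊗ X) n, ∀ b : complexBetti X k,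
          corrAction μ hF hX (rfl : k + 2 * n = k + 2 * n) γ b = complexBetti.map ν k b) :=
  ⟨fun hCPA _μ hμ _A _B _C _l _m _n k hA hB hC _γ hγ _γ' hγ' =>
      corrCompOfCup_holds hCPA hμ k hA hB hC hγ hγ',
    fun _μ hμ _F _X _d _n k hF hX ν => graphClassPullback_holds hμ k hF hX ν⟩

end Summit.HodgeConjecture.HodgeConjecture.Theorems.NikulinTwinTransport

end
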